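import Summits.ResolutionOfSingularities.ResolutionOfSingularities.Theorems.EquisingularLiftEquisingularLiftNatSpecialFibreCharts
import Summits.ResolutionOfSingularities.ResolutionOfSingularities.Theorems.EquisingularLiftEquisingularLiftNatEmbeddedLiftOfInfinitesimal
import HarnessLib

/-!
# [OURS · L1 W4.5(b) · EL♮(3) · WIDTH TABLE D8 «NODAL HOSTED ROUND (HR-KEEP-N)», support debt S-D8-LIFT, part 4, brick (N-C8)]
# THE `hres₁` BRIDGE — a lift given as an ideal sheaf on `X_{n+1}` restricts to `Y₀` over the model map `j₀ : X₀ → X`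

res-L1-w45b-stub-2 g19 (STUB WORKER 2), brick NAMED by the plan owner res-L1-w45b-stub-4 g14 (cell bus 2026-08-29T05:10:33Z, «(N-C8) the `hres₁`
bridge as a standalone lemma, general `n`»; split of record 2026-08-29T04:20:51Z).  OURS; NOT a statement of any manuscript ([Hironaka2017] is a
candidate under adjudication — nothing of it is asserted here); AI-written, weaker than expert review.  No `sorry`; standard axioms; DEF-FREE.
`--supports stmt-ResolutionOfSingularities-20148 --as helper`, counted 0.  EL♮(3) is NOT proved; resolution of singularities in positive characteristic
is NOT proved.

WHAT.  In the (π)-engine currency (tower `f : X ⟶ Spec A` along `I`, fibre model `(j₀, t₀)` over `q : A → k₀`, a closed `jn : Y_n ↪ X_n` with special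
fibre `ι : Y₀ → X₀`, i.e. J1's square `hs₀ : Y₀ = Y_n ×_X X₀`): if `G'` is an ideal sheaf on `X_{n+1}` with `G'.comap (transition n) = jn.ker` (a lift of
`Y_n`), then `Y₀ = V(G') ×_X X₀` along `j₀`, i.e. `∃ s₁ : Y₀ ⟶ V(G'), IsPullback s₁ ι (G'.subschemeι ≫ ι (n+1)) j₀` — EXACTLY the hypothesis `hres₁` of
✓ (N-C4) `exists_flat_lift_of_firstOrder` (there `n = 0`, `j₀ = jW`).  Proof: paste `Y₀ = Y_n ×_{X_n} X₀` (✓ `isPullback_fibreEmb_of_isPullback_ι`),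
`Y_n = V(G') ×_{X_{n+1}} X_n` ((γ♯), Mathlib `isPullback_of_isClosedImmersion`) and `V(G') = V(G') ×_X X_{n+1}` (`ι (n+1)` is a monomorphism), and read
the bottom row `e_n ≫ t_n ≫ ι_{n+1} = j₀` (`transition_ι`, `fibreEmb_ι`).
References (method / index only): R. Hartshorne, *Deformation Theory*, GTM 257 (2010), proof of Thm. 22.3 (the restriction squares of the tower).
-/

set_option linter.dupNamespace false -- mandated namespace `Summit.<Summit>.<Problem>` of this single-conjunct summit

noncomputable section

open CategoryTheory CategoryTheory.Limits AlgebraicGeometry TopologicalSpace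
open Literature.AlgebraicGeometry.Morphisms
open AlgebraicGeometry.Scheme.IdealSheafData

namespace Summit.ResolutionOfSingularities.ResolutionOfSingularities.Cruxes.EquisingularLiftNat.Sections

/-- ★ **(N-C8) THE `hres₁` BRIDGE.**  A lift of `Y_n ↪ X_n` to `X_{n+1}` given as an ideal sheaf `G'` (`G'.comap (transition n) = jn.ker`) restricts to
the special fibre: `Y₀ = V(G') ×_X X₀` along the model map `j₀`, in the shape of (N-C4)'s hypothesis `hres₁`.  See the module docstring.
[OURS · L1 W4.5b · (π) plumbing · folklore] -/
theorem exists_isPullback_subschemeι_ι_of_comap_eq_ker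
    {A : Type} [CommRing A] (I : Ideal A) {X : Scheme.{0}} (f : X ⟶ Spec (.of A)) {k₀ : Type} [CommRing k₀] (q : A →+* k₀)
    (hI : I ≤ RingHom.ker q) {X₀ : Scheme.{0}} {j₀ : X₀ ⟶ X} {t₀ : X₀ ⟶ Spec (.of k₀)}
    (hsq : IsPullback j₀ t₀ f (Spec.map (CommRingCat.ofHom q))) (n : ℕ)
    {Yn Y₀ : Scheme.{0}} {jn : Yn ⟶ infinitesimalNeighbourhood I f n} [IsClosedImmersion jn] {ι : Y₀ ⟶ X₀} {s₀ : Y₀ ⟶ Yn}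
    (hs₀ : IsPullback s₀ ι (jn ≫ infinitesimalNeighbourhood.ι I f n) j₀)
    (G' : (infinitesimalNeighbourhood I f (n + 1)).IdealSheafData)
    (hG' : G'.comap (infinitesimalNeighbourhood.transition I f n) = jn.ker) :
    ∃ s₁ : Y₀ ⟶ G'.subscheme, IsPullback s₁ ι (G'.subschemeι ≫ infinitesimalNeighbourhood.ι I f (n + 1)) j₀ := by
  -- `Y_n = V(G') ×_{X_{n+1}} X_n` ((γ♯))
  have hle : G'.subschemeι.ker ≤ (jn ≫ infinitesimalNeighbourhood.transition I f n).ker := by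
    rw [ker_subschemeι, ← map_ker, ← hG']
    exact G'.le_map_comap _
  have hsqB : IsPullback (IsClosedImmersion.lift G'.subschemeι _ hle) jn G'.subschemeι (infinitesimalNeighbourhood.transition I f n) :=
    (isPullback_of_isClosedImmersion jn G'.subschemeι (IsClosedImmersion.lift G'.subschemeι _ hle) (infinitesimalNeighbourhood.transition I f n)
      (by rw [IsClosedImmersion.lift_fac]) (by rw [ker_subschemeι, hG'])).flip
  -- `Y₀ = Y_n ×_{X_n} X₀`
  have hsqA : IsPullback s₀ ι jn (fibreEmb I f q hI hsq n) := isPullback_fibreEmb_of_isPullback_ι I f q hI hsq n hs₀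
  -- `V(G') = V(G') ×_X X_{n+1}`
  have hsqC : IsPullback (𝟙 G'.subscheme) G'.subschemeι (G'.subschemeι ≫ infinitesimalNeighbourhood.ι I f (n + 1))
      (infinitesimalNeighbourhood.ι I f (n + 1)) :=
    isPullback_id_of_mono G'.subschemeι (infinitesimalNeighbourhood.ι I f (n + 1))
  have h := (hsqA.paste_horiz hsqB).paste_horiz hsqC
  rw [Category.comp_id, Category.assoc, infinitesimalNeighbourhood.transition_ι, fibreEmb_ι] at h
  exact ⟨_, h⟩

end Summit.ResolutionOfSingularities.ResolutionOfSingularities.Cruxes.EquisingularLiftNat.Sections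

end
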